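import Literature.MathematicalPhysics.StatisticalMechanics.NJLTwoPointTransferOperatorClustering
import Literature.MathematicalPhysics.StatisticalMechanics.NJLWeakGoldstone
import Literature.MathematicalPhysics.QuantumFieldTheory.Balaban1983to89.Beta.RemainderConstNumerals
import HarnessLib

/-!
# The clustering rate of the NJL model vanishes with the mass
# (Salmhofer–Seiler, CMP 139 (1991), Remark 3.12 and Cor. 4.4 (4), (4.19); Erratum (5))

Salmhofer–Seiler, p. 409, Remark 3.12: "The Ward identities which one can derive by doing
space-dependent chiral rotations relate the expectation value of `ψ̄ψ` directly to its two-point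
function for staggered fermions, `⟨ψ̄ψ(y)⟩ = -m ∑_x ε(x)ε(y) ⟨ψ̄ψ(x)ψ̄ψ(y)⟩^T` (3.43) … Inserting
the exponential decay with rate `κ(m)` into this equation one sees that if chiral symmetry is
broken in the sense of `X ≠ 0`, the mass gap `κ(m)` must go to zero as the mass vanishes."
P. 420, Corollary 4.4 (4): "The chiral Ward identity (3.43) and `X ≠ 0` imply that the clustering
rate `κ(m)` satisfies `κ(m) ≤ const m^{1/ν}` (4.19) as `m → 0`."  Erratum, p. 638: "Only for the
proof that the mass gap must go to zero as `m` vanishes, Remark 3.12 and the bound (4.19), we had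
to show that `B₂(m)` is absent for real `m`" — i.e. these two statements rest on the prefactor-free
clustering (5), `|⟨σ_0σ_x⟩ - ⟨σ_0⟩⟨σ_x⟩| ≤ e^{-κ(m)|x|}`, which the tree has as
`njl_twoPoint_clustering_prefactorFree` (`NJLTwoPointTransferOperatorClustering`).

The tree's `NJLWeakGoldstone` proved Remark 3.12 in the weaker form supported WITHOUT (5) (the
clustering CONSTANTS `(κ, C)` cannot be uniform as `m → 0`).  This file proves the printed
statements, for the β = 0 NJL system in the infinite volume:

1. `tsum_exp_neg_mul_abs_int_le(')` — `G(a) = ∑_{j∈ℤ} e^{-a|j|} = (1+e^{-a})/(1-e^{-a})` (the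
   tree's `hasSum_exp_neg_abs_int`) `≤ 2(1+a)/a` (`≤ 4/a` for `a ≤ 1`).
2. `njlTruncTorus` (the finite-volume `⟨σ_zσ_0⟩_Λ - ⟨σ_z⟩_Λ⟨σ_0⟩_Λ`), the Ward inequality
   `⟨σ_0⟩_Λ ≤ 2Nm ∑_z |…|` (tree), its domination `|…| ≤ C ∏_j e^{-(κ₀/ν)|z̃_j|}` at fixed `m`
   (Thm. 3.11, tree), the split `∑_z |…| ≤ ∑_{|x|_∞≤R} |…(x̄)| + C G(a/2)^ν e^{-aR/2}`
   (`sum_abs_njlTruncTorus_le`), and the convergence `…(x̄) → T(x) - s²` (Cor. 3.9).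
3. `njlCondensate_le_of_prefactorFree` — **Remark 3.12 with (5)**: if (5) holds at `m > 0` with
   rate `κ`, then `s(m) ≤ 2Nm G(κ/ν)^ν` (finite volume → `L → ∞` at fixed `R` → `R → ∞`;
   `e^{-κ max_i|x_i|} ≤ ∏_i e^{-(κ/ν)|x_i|}`); `njlCondensate_mul_rate_pow_le` —
   `s(m) κ^ν ≤ 2N(4ν)^ν m` for `κ ≤ ν`.
4. `njl_clusteringRate_le_rpow_of_orderParameter` — **Cor. 4.4 (4), (4.19)** with its printed
   hypothesis `X ≠ 0` (`liminf_{m→0+} s(m) > 0`, any `ν ≥ 1`): there are `c, m₀ > 0` with: for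
   `0 < m < m₀`, EVERY rate `κ` of (5) at `m` obeys `κ ≤ c m^{1/ν}`; `njl_clusteringRate_le_rpow` —
   the same under `2S(ν)/N < 1`, `ν ≥ 3` (Cor. 4.4 (1) of the tree gives `X ≠ 0`); primed version
   hypothesis-free for QED (`N = 1`, `ν ≥ 4`) and `N ≥ 2`, `ν ≥ 3`;
   `njl_exists_clusteringRate_le_rpow` — and such rates exist (Erratum (5)).
5. `njl_clusteringRate_tendsto_zero` — **Remark 3.12 as printed**: every selection of rates
   `κ(m)` of (5) tends to `0` as `m → 0+`.

Faithfulness / scope.  (i) "The clustering rate `κ(m)`" of the print is not a uniquely defined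
object; the theorems quantify over ALL rates admissible in (5) at the given mass, which covers any
reading (in particular the optimal rate).  (ii) The constant in (4.19): `c = (4N(4ν)^ν/ℓ)^{1/ν}`,
`ℓ = liminf_{m→0+} s(m)`; the print's "const" is unspecified.  (iii) Infinite volume along tori
(the tree's Thm. 3.8), `m > 0` (the Erratum's (5) is in the tree for `m > 0`).  (iv) Honest
framing: β = 0 NJL ∕ strongly coupled lattice QED statements about the effective spin model;
nothing about β > 0, the continuum, a genuine Goldstone boson, or the summit's `QCD` conjunct.

## References

* M. Salmhofer, E. Seiler, *Proof of chiral symmetry breaking in strongly coupled lattice gauge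
  theory*, Commun. Math. Phys. 139 (1991) 395–432: Remark 3.12 and (3.43) p. 409, Cor. 4.4 (4)
  (4.19) p. 420, Cor. 4.4 (1). [SalmhoferSeiler1991]
* M. Salmhofer, E. Seiler, Erratum, Commun. Math. Phys. 146 (1992) 637–638: (5) and the last
  paragraph. [SalmhoferSeiler1992Erratum]
-/

noncomputable section

open Filter Topology MvPolynomial Finset

namespace Literature.MathematicalPhysics.StatisticalMechanics

namespace ComplexSpin

open Literature.Probability.LatticeModels (TorusSite Site)
open Literature.Probability.LatticeModels
open Literature.MathematicalPhysics.QuantumFieldTheory.Balaban1983to89.Beta.RemainderConstNumerals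
  (hasSum_exp_neg_abs_int)

variable {ν : ℕ}

/-! ### The two-sided geometric series `G(a) = ∑_{j∈ℤ} e^{-a|j|}` -/

/-- **`G(a) = ∑_{j∈ℤ} e^{-a|j|} ≤ 2(1 + a)/a`** (`1 - e^{-a} ≥ a/(1+a)`).
[cite: SalmhoferSeiler1991, Remark 3.12 and Cor. 4.4 (4)] -/
theorem tsum_exp_neg_mul_abs_int_le {a : ℝ} (ha : 0 < a) :
    ∑' j : ℤ, Real.exp (-a * |(j : ℝ)|) ≤ 2 * (1 + a) / a := by
  rw [(hasSum_exp_neg_abs_int ha).tsum_eq]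
  set q : ℝ := Real.exp (-a) with hq
  have hq0 : 0 < q := Real.exp_pos _
  have hq1 : q < 1 := Real.exp_lt_one_iff.2 (by linarith)
  have hqa : q * (1 + a) ≤ 1 := by
    have h1 : 1 + a ≤ Real.exp a := by linarith [Real.add_one_le_exp a]
    have h2 : q * Real.exp a = 1 := by rw [hq, ← Real.exp_add]; simp
    nlinarith [hq0]
  rw [div_le_div_iff₀ (by linarith) ha]
  nlinarith

/-- `G(a) ≤ 4/a` for `0 < a ≤ 1`. [cite: SalmhoferSeiler1991, Cor. 4.4 (4)] -/
theorem tsum_exp_neg_mul_abs_int_le' {a : ℝ} (ha : 0 < a) (ha1 : a ≤ 1) :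
    ∑' j : ℤ, Real.exp (-a * |(j : ℝ)|) ≤ 4 / a := by
  refine (tsum_exp_neg_mul_abs_int_le ha).trans ?_
  rw [div_le_div_iff₀ ha ha]
  nlinarith

/-! ### Lattice sums of products of exponentials -/

/-- The centred representative of a torus point (`z̃_j ∈ (-L/2, L/2]`). [cite: SalmhoferSeiler1991, Def. 3.13 (the torus `Λ`)] -/
def torusRep {L : ℕ} (z : TorusSite ν L) : Site ν := fun j => ZMod.valMinAbs (z j)

/-- `proj (z̃) = z`. [cite: SalmhoferSeiler1991, Def. 3.13] -/
theorem proj_torusRep {L : ℕ} [NeZero L] (z : TorusSite ν L) : Torus.proj L (torusRep z) = z := by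
  funext j; simp [torusRep, ZMod.coe_valMinAbs]

/-- `z ↦ z̃` is injective. [cite: SalmhoferSeiler1991, Def. 3.13] -/
theorem torusRep_injective {L : ℕ} [NeZero L] : Function.Injective (torusRep (ν := ν) (L := L)) :=
  fun z w h => by rw [← proj_torusRep z, ← proj_torusRep w, h]

/-- `0̃ = 0`. [cite: SalmhoferSeiler1991, Def. 3.13] -/
theorem torusRep_zero {L : ℕ} [NeZero L] : torusRep (0 : TorusSite ν L) = 0 := by
  funext j; simp [torusRep]

/-- On the torus: `∑_z ∏_j e^{-b|z̃_j|} ≤ G(b)^ν`, uniformly in `L`. [cite: SalmhoferSeiler1991, Remark 3.12] -/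
theorem sum_prod_exp_neg_torusRep_le {b : ℝ} (hb : 0 < b) (L : ℕ) [NeZero L] :
    ∑ z : TorusSite ν L, ∏ j : Fin ν, Real.exp (-b * |((torusRep z j : ℤ) : ℝ)|) ≤
      (∑' t : ℤ, Real.exp (-b * |(t : ℝ)|)) ^ ν := by
  classical
  have heq : ∑ z : TorusSite ν L, ∏ j : Fin ν, Real.exp (-b * |((torusRep z j : ℤ) : ℝ)|) =
      (∑ t : ZMod L, Real.exp (-b * |((ZMod.valMinAbs t : ℤ) : ℝ)|)) ^ ν := by
    rw [Fintype.sum_pow]; rfl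
  rw [heq]
  refine pow_le_pow_left₀ (Finset.sum_nonneg fun _ _ => (Real.exp_pos _).le) ?_ ν
  have hinj : Set.InjOn (ZMod.valMinAbs : ZMod L → ℤ) (Finset.univ : Finset (ZMod L)) :=
    fun x _ y _ h => ZMod.injective_valMinAbs h
  rw [← Finset.sum_image (f := fun t : ℤ => Real.exp (-b * |(t : ℝ)|)) hinj]
  exact (hasSum_exp_neg_abs_int hb).summable.sum_le_tsum _ fun _ _ => (Real.exp_pos _).le

/-- The box `{|x|_∞ ≤ R} ⊂ ℤ^ν`. [cite: SalmhoferSeiler1991, Remark 3.12] -/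
def latBox (ν R : ℕ) : Finset (Site ν) := Fintype.piFinset fun _ : Fin ν => Finset.Icc (-(R : ℤ)) R

/-- Membership in the box. [cite: SalmhoferSeiler1991, Remark 3.12] -/
theorem mem_latBox {R : ℕ} {x : Site ν} : x ∈ latBox ν R ↔ ∀ j, |x j| ≤ R := by
  simp [latBox, Fintype.mem_piFinset, abs_le]

/-- `∑_{|x|_∞ ≤ R} ∏_j e^{-b|x_j|} ≤ G(b)^ν`. [cite: SalmhoferSeiler1991, Remark 3.12] -/
theorem sum_latBox_prod_exp_neg_le {b : ℝ} (hb : 0 < b) (R : ℕ) :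
    ∑ x ∈ latBox ν R, ∏ j : Fin ν, Real.exp (-b * |((x j : ℤ) : ℝ)|) ≤
      (∑' t : ℤ, Real.exp (-b * |(t : ℝ)|)) ^ ν := by
  rw [latBox, Finset.sum_prod_piFinset (Finset.Icc (-(R : ℤ)) R)
    (fun (_ : Fin ν) (t : ℤ) => Real.exp (-b * |((t : ℤ) : ℝ)|)), Finset.prod_const, Finset.card_univ,
    Fintype.card_fin]
  refine pow_le_pow_left₀ (Finset.sum_nonneg fun _ _ => (Real.exp_pos _).le) ?_ ν
  exact (hasSum_exp_neg_abs_int hb).summable.sum_le_tsum _ fun _ _ => (Real.exp_pos _).le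

/-- A bound by `e^{-κ|x_i|}` in EVERY direction is a bound by `∏_j e^{-(κ/ν)|x_j|}`
(`max_i |x_i| ≥ (1/ν)∑_j |x_j|`). [cite: SalmhoferSeiler1991, Remark 3.12] -/
theorem le_prod_exp_of_forall_le_exp (hν : 1 ≤ ν) {κ g : ℝ} (hκ : 0 ≤ κ) {x : Site ν}
    (h : ∀ i : Fin ν, g ≤ Real.exp (-κ * |(x i : ℝ)|)) :
    g ≤ ∏ j : Fin ν, Real.exp (-(κ / ν) * |((x j : ℤ) : ℝ)|) := by
  haveI : Nonempty (Fin ν) := ⟨⟨0, by omega⟩⟩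
  have hνpos : (0 : ℝ) < ν := by exact_mod_cast (show 0 < ν by omega)
  obtain ⟨i, -, hi⟩ := Finset.exists_max_image Finset.univ (fun j => |(x j : ℝ)|) Finset.univ_nonempty
  refine (h i).trans ?_
  rw [← Real.exp_sum, Real.exp_le_exp, ← Finset.mul_sum]
  have hsum : ∑ j : Fin ν, |((x j : ℤ) : ℝ)| ≤ ν * |(x i : ℝ)| := by
    calc ∑ j : Fin ν, |((x j : ℤ) : ℝ)| ≤ ∑ _j : Fin ν, |(x i : ℝ)| :=
          Finset.sum_le_sum fun j _ => hi j (Finset.mem_univ j)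
      _ = ν * |(x i : ℝ)| := by rw [Finset.sum_const, Finset.card_univ, Fintype.card_fin]; ring
  have : κ / ν * ∑ j : Fin ν, |((x j : ℤ) : ℝ)| ≤ κ * |(x i : ℝ)| := by
    calc κ / ν * ∑ j : Fin ν, |((x j : ℤ) : ℝ)| ≤ κ / ν * (ν * |(x i : ℝ)|) :=
          mul_le_mul_of_nonneg_left hsum (div_nonneg hκ hνpos.le)
      _ = κ * |(x i : ℝ)| := by field_simp
  linarith

/-! ### The finite-volume truncated two-point function and its domination -/

/-- The finite-volume truncated two-point function `⟨σ_zσ_0⟩_Λ - ⟨σ_z⟩_Λ⟨σ_0⟩_Λ` of the NJL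
system (the summand of the Ward inequality of Remark 3.12). [cite: SalmhoferSeiler1991, (3.43) and Remark 3.12] -/
def njlTruncTorus (N : ℕ) (m : ℝ) {L : ℕ} [NeZero L] (z : TorusSite ν L) : ℝ :=
  expect N m (njlBondCoeff N) (X z * X 0) -
    expect N m (njlBondCoeff N) (X z) * expect (ν := ν) (L := L) N m (njlBondCoeff N) (X 0)

/-- **The Ward inequality** (3.43) with truncation (tree: `njl_expect_X_le_sum_abs_truncated`):
`⟨σ_0⟩_Λ ≤ 2Nm ∑_z |⟨σ_zσ_0⟩_Λ - ⟨σ_z⟩_Λ⟨σ_0⟩_Λ|`. [cite: SalmhoferSeiler1991, (3.43) and Remark 3.12] -/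
theorem njl_expect_X_le_sum_abs_njlTruncTorus (hν : 1 ≤ ν) {N : ℕ} (hN : 1 ≤ N) {L : ℕ} [NeZero L]
    (hL : Even L) {m : ℝ} (hm : 0 < m) :
    expect (ν := ν) (L := L) N m (njlBondCoeff N) (X 0) ≤
      2 * N * m * ∑ z : TorusSite ν L, |njlTruncTorus N m z| :=
  njl_expect_X_le_sum_abs_truncated hν hN hL hm

/-- **The finite-volume domination** (Thm. 3.11 at fixed `m`, the tree's
`njl_clustering_constants_at_fixed_mass`): for real `m ≠ 0` there are `κ₀ > 0`, `C ≥ 0` with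
`|⟨σ_zσ_0⟩_Λ - ⟨σ_z⟩_Λ⟨σ_0⟩_Λ| ≤ C ∏_j e^{-(κ₀/ν)|z̃_j|}` for all `z ≠ 0` on every torus.
[cite: SalmhoferSeiler1991, Thm. 3.11][cite: SalmhoferSeiler1992Erratum, (1)] -/
theorem abs_njlTruncTorus_le_prod_exp (hν : 1 ≤ ν) {N : ℕ} (hN : 1 ≤ N) {m : ℝ} (hm : m ≠ 0) :
    ∃ κ₀ : ℝ, 0 < κ₀ ∧ ∃ C : ℝ, 0 ≤ C ∧ ∀ (L : ℕ) [NeZero L] (z : TorusSite ν L), z ≠ 0 →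
      |njlTruncTorus N m z| ≤ C * ∏ j : Fin ν, Real.exp (-(κ₀ / ν) * |((torusRep z j : ℤ) : ℝ)|) := by
  obtain ⟨κ₀, hκ₀, C, hC, hcl⟩ := njl_clustering_constants_at_fixed_mass hν hN hm
  refine ⟨κ₀, hκ₀, C, hC, fun L _ z hz => ?_⟩
  haveI : Nonempty (Fin ν) := ⟨⟨0, by omega⟩⟩
  set x : Site ν := torusRep z with hx
  obtain ⟨i, -, hi⟩ := Finset.exists_max_image Finset.univ (fun j => (x j).natAbs) Finset.univ_nonempty
  obtain ⟨j, hj⟩ : ∃ j, z j ≠ 0 := by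
    by_contra h
    push Not at h
    exact hz (funext h)
  have hD1 : 1 ≤ (x i).natAbs := by
    have h1 : (x j).natAbs ≠ 0 := by
      rw [ne_eq, Int.natAbs_eq_zero, hx]
      exact fun h0 => hj ((ZMod.valMinAbs_eq_zero _).1 h0)
    have h2 := hi j (Finset.mem_univ j)
    omega
  have hDle : ((x i).natAbs : ℤ) ≤ |x i - (0 : Site ν) i| := by
    rw [Pi.zero_apply, sub_zero, ← Int.natCast_natAbs]
  have hDL : |x i - (0 : Site ν) i| + ((x i).natAbs : ℤ) ≤ L := by
    have h1 : (x i).natAbs ≤ L / 2 := ZMod.natAbs_valMinAbs_le (z i)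
    have h2 : 2 * (L / 2) ≤ L := Nat.mul_div_le L 2
    have h3 : (x i).natAbs + (x i).natAbs ≤ L := by omega
    rw [Pi.zero_apply, sub_zero, ← Int.natCast_natAbs]
    exact_mod_cast h3
  have key := hcl L x 0 i (x i).natAbs hD1 hDle hDL
  have hpair : (monomial (Finsupp.mapDomain (Torus.proj L) (Finsupp.single x 1 + Finsupp.single 0 1))
      (1 : ℝ) : MvPolynomial (TorusSite ν L) ℝ) = X z * X 0 := by
    rw [Finsupp.mapDomain_add, Finsupp.mapDomain_single, Finsupp.mapDomain_single, hx,
      proj_torusRep, torusProj_zero, X, X, monomial_mul, mul_one]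
  have hsx : (monomial (Finsupp.mapDomain (Torus.proj L) (Finsupp.single x 1)) (1 : ℝ) :
      MvPolynomial (TorusSite ν L) ℝ) = X z := by
    rw [Finsupp.mapDomain_single, hx, proj_torusRep, X]
  have hs0 : (monomial (Finsupp.mapDomain (Torus.proj L) (Finsupp.single (0 : Site ν) 1)) (1 : ℝ) :
      MvPolynomial (TorusSite ν L) ℝ) = X 0 := by
    rw [Finsupp.mapDomain_single, torusProj_zero, X]
  rw [hpair, hsx, hs0] at key
  refine key.trans (mul_le_mul_of_nonneg_left ?_ hC)
  refine le_prod_exp_of_forall_le_exp hν hκ₀.le fun j => ?_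
  rw [Real.exp_le_exp]
  have h1 : |((x j : ℤ) : ℝ)| ≤ ((x i).natAbs : ℝ) := by
    rw [← Int.cast_abs, ← Int.natCast_natAbs, Int.cast_natCast]
    exact_mod_cast hi j (Finset.mem_univ j)
  nlinarith

/-- **Splitting the Ward sum at `|z̃|_∞ ≤ R`**: with a domination
`|t_Λ(z)| ≤ C ∏_j e^{-a|z̃_j|}` (`z ≠ 0`),
`∑_z |t_Λ(z)| ≤ ∑_{|x|_∞ ≤ R} |t_Λ(x̄)| + C G(a/2)^ν e^{-aR/2}` on every torus.
[cite: SalmhoferSeiler1991, Remark 3.12] -/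
theorem sum_abs_njlTruncTorus_le {N : ℕ} {m : ℝ} {L : ℕ} [NeZero L] (R : ℕ) {a C : ℝ} (ha : 0 < a)
    (hC : 0 ≤ C)
    (hdom : ∀ z : TorusSite ν L, z ≠ 0 →
      |njlTruncTorus N m z| ≤ C * ∏ j : Fin ν, Real.exp (-a * |((torusRep z j : ℤ) : ℝ)|)) :
    ∑ z : TorusSite ν L, |njlTruncTorus N m z| ≤
      ∑ x ∈ latBox ν R, |njlTruncTorus N m (Torus.proj L x)| +
        C * (∑' t : ℤ, Real.exp (-(a / 2) * |(t : ℝ)|)) ^ ν * Real.exp (-(a / 2) * R) := by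
  classical
  set A : Finset (TorusSite ν L) := Finset.univ.filter fun z => ∀ j, |torusRep z j| ≤ R with hA
  set B : Finset (TorusSite ν L) := Finset.univ.filter fun z => ¬ ∀ j, |torusRep z j| ≤ R with hB
  have hsplit : ∑ z : TorusSite ν L, |njlTruncTorus N m z| =
      ∑ z ∈ A, |njlTruncTorus N m z| + ∑ z ∈ B, |njlTruncTorus N m z| :=
    (Finset.sum_filter_add_sum_filter_not Finset.univ (fun z : TorusSite ν L => ∀ j, |torusRep z j| ≤ R) _).symm
  rw [hsplit]
  refine add_le_add ?_ ?_
  · -- inner part: reparametrise by the representative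
    have hinj : Set.InjOn (torusRep (ν := ν) (L := L)) ↑A := fun z _ w _ h => torusRep_injective h
    have heq : ∑ z ∈ A, |njlTruncTorus N m z| =
        ∑ x ∈ A.image torusRep, |njlTruncTorus N m (Torus.proj L x)| := by
      rw [Finset.sum_image hinj]
      refine Finset.sum_congr rfl fun z _ => ?_
      rw [proj_torusRep]
    rw [heq]
    refine Finset.sum_le_sum_of_subset_of_nonneg ?_ fun _ _ _ => abs_nonneg _
    intro x hx
    rw [Finset.mem_image] at hx
    obtain ⟨z, hz, rfl⟩ := hx
    rw [hA, Finset.mem_filter] at hz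
    exact mem_latBox.2 hz.2
  · -- outer part: domination, and `∑_j |z̃_j| > R` there
    calc ∑ z ∈ B, |njlTruncTorus N m z|
        ≤ ∑ z ∈ B, C * Real.exp (-(a / 2) * R) *
            ∏ j : Fin ν, Real.exp (-(a / 2) * |((torusRep z j : ℤ) : ℝ)|) := by
          refine Finset.sum_le_sum fun z hz => ?_
          rw [hB, Finset.mem_filter] at hz
          obtain ⟨j₀, hj₀⟩ := not_forall.1 hz.2
          rw [not_le] at hj₀
          have hz0 : z ≠ 0 := by
            rintro rfl
            rw [torusRep_zero, Pi.zero_apply, abs_zero] at hj₀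
            omega
          refine (hdom z hz0).trans ?_
          rw [mul_assoc]
          refine mul_le_mul_of_nonneg_left ?_ hC
          rw [← Real.exp_sum, ← Real.exp_sum, ← Real.exp_add, Real.exp_le_exp, ← Finset.mul_sum,
            ← Finset.mul_sum]
          have hsum : (R : ℝ) ≤ ∑ j : Fin ν, |((torusRep z j : ℤ) : ℝ)| := by
            have h1 : (R : ℝ) ≤ |((torusRep z j₀ : ℤ) : ℝ)| := by
              rw [← Int.cast_abs]; exact_mod_cast hj₀.le
            exact h1.trans (Finset.single_le_sum (f := fun j => |((torusRep z j : ℤ) : ℝ)|)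
              (fun _ _ => abs_nonneg _) (Finset.mem_univ j₀))
          nlinarith [hsum, ha]
      _ ≤ C * Real.exp (-(a / 2) * R) * (∑' t : ℤ, Real.exp (-(a / 2) * |(t : ℝ)|)) ^ ν := by
          rw [← Finset.mul_sum]
          refine mul_le_mul_of_nonneg_left ?_ (by positivity)
          refine (Finset.sum_le_sum_of_subset_of_nonneg (Finset.filter_subset _ _) fun _ _ _ =>
            Finset.prod_nonneg fun _ _ => (Real.exp_pos _).le).trans ?_
          exact sum_prod_exp_neg_torusRep_le (half_pos ha) L
      _ = C * (∑' t : ℤ, Real.exp (-(a / 2) * |(t : ℝ)|)) ^ ν * Real.exp (-(a / 2) * R) := by ring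

/-- **The truncated function converges**: `⟨σ_{x̄}σ_0⟩_Λ - ⟨σ_{x̄}⟩_Λ⟨σ_0⟩_Λ → T(x) - s²` along
the even tori (Cor. 3.9). [cite: SalmhoferSeiler1991, Cor. 3.9 and (3.100)] -/
theorem tendsto_njlTruncTorus {N : ℕ} (hN : 1 ≤ N) (hν : 1 ≤ ν) {m : ℝ} (hm : m ≠ 0) (x : Site ν)
    (Ls : ℕ → ℕ) [∀ j, NeZero (Ls j)] (hLs : Tendsto Ls atTop atTop) :
    Tendsto (fun j => njlTruncTorus N m (Torus.proj (Ls j) x)) atTop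
      (𝓝 (njlTwoPoint N m x - njlCondensate ν N m ^ 2)) := by
  have h1 := tendsto_njlState hN hν hm (X x * X (0 : Site ν)) Ls hLs
  have h2 := tendsto_njlState hN hν hm (X x) Ls hLs
  have h3 := tendsto_njlState hN hν hm (X (0 : Site ν)) Ls hLs
  simp_rw [map_mul, rename_X, torusProj_zero] at h1
  simp_rw [rename_X] at h2
  simp_rw [rename_X, torusProj_zero] at h3
  rw [njlState_X_mul_X, zero_sub, njlTwoPoint_neg] at h1
  rw [njlState_X] at h2
  have h := h1.sub (h2.mul h3)
  rw [← njlCondensate, ← sq] at h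
  exact h

/-- `s(m) ≥ 0` for `m > 0` (Thm. 3.18 (1) in the limit). [cite: SalmhoferSeiler1991, Thm. 3.18 (1)] -/
theorem njlCondensate_nonneg (hν : 1 ≤ ν) {N : ℕ} (hN : 1 ≤ N) {m : ℝ} (hm : 0 < m) :
    0 ≤ njlCondensate ν N m := by
  haveI := neZero_two_mul_add_two
  have h := tendsto_njlState hN hν hm.ne' (X (0 : Site ν)) (fun j => 2 * j + 2) tendsto_two_mul_add_two
  simp_rw [rename_X, torusProj_zero] at h
  exact ge_of_tendsto h (Eventually.of_forall fun j =>
    njl_expect_X_nonneg hν (L := 2 * j + 2) ⟨j + 1, by ring⟩ hN hm.le 0)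

/-- **Remark 3.12 with the Erratum's (5), in the infinite volume**: for the NJL model (`N ≥ 1`,
`ν ≥ 1`) at real `m > 0`, if the truncated two-point function obeys the prefactor-free bound (5)
with a rate `κ > 0` — `|⟨σ_0σ_x⟩ - ⟨σ_0⟩⟨σ_x⟩| ≤ e^{-κ|x_i|}` for all `x ∈ ℤ^ν` and all `i` — then
the Ward identity (3.43) bounds the condensate by the mass: `s(m) ≤ 2Nm G(κ/ν)^ν`,
`G(a) = ∑_{j∈ℤ} e^{-a|j|}` ("inserting the exponential decay with rate `κ(m)` into this
equation …"). [cite: SalmhoferSeiler1991, Remark 3.12 and (3.43)][cite: SalmhoferSeiler1992Erratum, (5)] -/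
theorem njlCondensate_le_of_prefactorFree (hν : 1 ≤ ν) {N : ℕ} (hN : 1 ≤ N) {m : ℝ} (hm : 0 < m)
    {κ : ℝ} (hκ : 0 < κ)
    (hcl : ∀ (x : Site ν) (i : Fin ν),
      |njlTwoPoint N m x - njlCondensate ν N m ^ 2| ≤ Real.exp (-κ * |(x i : ℝ)|)) :
    njlCondensate ν N m ≤ 2 * N * m * (∑' j : ℤ, Real.exp (-(κ / ν) * |(j : ℝ)|)) ^ ν := by
  classical
  haveI := neZero_two_mul_add_two
  have hνpos : (0 : ℝ) < ν := by exact_mod_cast (show 0 < ν by omega)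
  have h2Nm : 0 ≤ 2 * (N : ℝ) * m := by positivity
  set s := njlCondensate ν N m with hs
  set G : ℝ := ∑' j : ℤ, Real.exp (-(κ / ν) * |(j : ℝ)|) with hG
  obtain ⟨κ₀, hκ₀, C, hC, hdom⟩ := abs_njlTruncTorus_le_prod_exp hν hN hm.ne'
  set a : ℝ := κ₀ / ν with ha
  have ha0 : 0 < a := div_pos hκ₀ hνpos
  set G₂ : ℝ := ∑' j : ℤ, Real.exp (-(a / 2) * |(j : ℝ)|) with hG₂
  set g : Site ν → ℝ := fun x => njlTwoPoint N m x - s ^ 2 with hg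
  -- for every `R`: `s ≤ 2Nm (∑_{|x|_∞ ≤ R} |g(x)| + C G₂^ν e^{-aR/2})` (finite volume, then `L → ∞`)
  have hR : ∀ R : ℕ, s ≤ 2 * N * m *
      (∑ x ∈ latBox ν R, |g x| + C * G₂ ^ ν * Real.exp (-(a / 2) * R)) := by
    intro R
    have hsL : Tendsto (fun j => expect (ν := ν) (L := 2 * j + 2) N m (njlBondCoeff N) (X 0))
        atTop (𝓝 s) := by
      have h := tendsto_njlState hN hν hm.ne' (X (0 : Site ν)) (fun j => 2 * j + 2)
        tendsto_two_mul_add_two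
      simp_rw [rename_X, torusProj_zero] at h
      exact h
    have hrhs : Tendsto (fun j => 2 * N * m * (∑ x ∈ latBox ν R,
        |njlTruncTorus N m (Torus.proj (2 * j + 2) x)| + C * G₂ ^ ν * Real.exp (-(a / 2) * R)))
        atTop (𝓝 (2 * N * m * (∑ x ∈ latBox ν R, |g x| + C * G₂ ^ ν * Real.exp (-(a / 2) * R)))) := by
      refine Tendsto.const_mul _ (Tendsto.add ?_ tendsto_const_nhds)
      exact tendsto_finsetSum _ fun x _ => (continuous_abs.tendsto _).comp
        (tendsto_njlTruncTorus hN hν hm.ne' x (fun j => 2 * j + 2) tendsto_two_mul_add_two)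
    refine le_of_tendsto_of_tendsto' hsL hrhs fun j => ?_
    exact (njl_expect_X_le_sum_abs_njlTruncTorus hν hN ⟨j + 1, by ring⟩ hm).trans
      (mul_le_mul_of_nonneg_left (sum_abs_njlTruncTorus_le R ha0 hC (hdom (2 * j + 2))) h2Nm)
  -- (5): `∑_{|x|_∞ ≤ R} |g(x)| ≤ G(κ/ν)^ν`
  have hbox : ∀ R : ℕ, ∑ x ∈ latBox ν R, |g x| ≤ G ^ ν := by
    intro R
    refine (Finset.sum_le_sum fun x _ => le_prod_exp_of_forall_le_exp hν hκ.le (hcl x)).trans ?_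
    exact sum_latBox_prod_exp_neg_le (div_pos hκ hνpos) R
  -- `R → ∞`
  have hlim : Tendsto (fun R : ℕ => 2 * N * m * (G ^ ν + C * G₂ ^ ν * Real.exp (-(a / 2) * R)))
      atTop (𝓝 (2 * N * m * (G ^ ν + C * G₂ ^ ν * 0))) := by
    refine Tendsto.const_mul _ (tendsto_const_nhds.add (Tendsto.const_mul _ ?_))
    have : Tendsto (fun R : ℕ => -(a / 2) * (R : ℝ)) atTop atBot :=
      tendsto_natCast_atTop_atTop.const_mul_atTop_of_neg (by linarith)
    exact Real.tendsto_exp_atBot.comp this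
  rw [mul_zero, add_zero] at hlim
  exact ge_of_tendsto hlim (Eventually.of_forall fun R =>
    (hR R).trans (mul_le_mul_of_nonneg_left (add_le_add (hbox R) le_rfl) h2Nm))

/-- **(4.19), quantitative form at every mass**: for the NJL model (`N ≥ 1`, `ν ≥ 1`), real
`m > 0` and every rate `0 < κ ≤ ν` for which the prefactor-free clustering (5) holds,
`s(m) κ^ν ≤ 2N (4ν)^ν m` (Remark 3.12 with `G(κ/ν) ≤ 4ν/κ`). [cite: SalmhoferSeiler1991, Remark 3.12 and Cor. 4.4 (4) (4.19)][cite: SalmhoferSeiler1992Erratum, (5)] -/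
theorem njlCondensate_mul_rate_pow_le (hν : 1 ≤ ν) {N : ℕ} (hN : 1 ≤ N) {m : ℝ} (hm : 0 < m)
    {κ : ℝ} (hκ : 0 < κ) (hκν : κ ≤ ν)
    (hcl : ∀ (x : Site ν) (i : Fin ν),
      |njlTwoPoint N m x - njlCondensate ν N m ^ 2| ≤ Real.exp (-κ * |(x i : ℝ)|)) :
    njlCondensate ν N m * κ ^ ν ≤ 2 * N * (4 * ν) ^ ν * m := by
  have hνpos : (0 : ℝ) < ν := by exact_mod_cast (show 0 < ν by omega)
  have h := njlCondensate_le_of_prefactorFree hν hN hm hκ hcl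
  set G : ℝ := ∑' j : ℤ, Real.exp (-(κ / ν) * |(j : ℝ)|) with hG
  have hG0 : 0 ≤ G := tsum_nonneg fun _ => (Real.exp_pos _).le
  have hGle : G ≤ 4 * ν / κ := by
    have h1 := tsum_exp_neg_mul_abs_int_le' (div_pos hκ hνpos) (by rwa [div_le_one hνpos])
    rw [div_div_eq_mul_div] at h1
    exact h1
  have hpow : G ^ ν * κ ^ ν ≤ (4 * ν) ^ ν := by
    rw [← mul_pow]
    refine pow_le_pow_left₀ (mul_nonneg hG0 hκ.le) ?_ ν
    calc G * κ ≤ 4 * ν / κ * κ := mul_le_mul_of_nonneg_right hGle hκ.le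
      _ = 4 * ν := div_mul_cancel₀ _ hκ.ne'
  have h2Nm : 0 ≤ 2 * (N : ℝ) * m := by positivity
  calc njlCondensate ν N m * κ ^ ν ≤ 2 * N * m * G ^ ν * κ ^ ν :=
        mul_le_mul_of_nonneg_right h (pow_nonneg hκ.le ν)
    _ = 2 * N * m * (G ^ ν * κ ^ ν) := by ring
    _ ≤ 2 * N * m * (4 * ν) ^ ν := mul_le_mul_of_nonneg_left hpow h2Nm
    _ = 2 * N * (4 * ν) ^ ν * m := by ring

/-- A bound (5) with rate `κ` implies (5) with any smaller rate. [cite: SalmhoferSeiler1992Erratum, (5)] -/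
theorem prefactorFree_mono {N : ℕ} {m : ℝ} {κ κ' : ℝ} (hκ' : κ' ≤ κ)
    (hcl : ∀ (x : Site ν) (i : Fin ν),
      |njlTwoPoint N m x - njlCondensate ν N m ^ 2| ≤ Real.exp (-κ * |(x i : ℝ)|)) :
    ∀ (x : Site ν) (i : Fin ν),
      |njlTwoPoint N m x - njlCondensate ν N m ^ 2| ≤ Real.exp (-κ' * |(x i : ℝ)|) :=
  fun x i => (hcl x i).trans (Real.exp_le_exp.2 (by nlinarith [abs_nonneg (x i : ℝ)]))

/-- **Corollary 4.4 (4) with its printed hypothesis `X ≠ 0`**: for the NJL model (`N ≥ 1`,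
`ν ≥ 1`), if the chiral order parameter is nonzero in the sense `liminf_{m→0+} s(m) > 0`
(`X = 2N liminf_{m→0} s(m)`, Cor. 4.4 (1)), then there are `c > 0` and `m₀ > 0` such that for
every mass `0 < m < m₀`, EVERY rate `κ > 0` for which the prefactor-free clustering (5) holds at
`m` satisfies `κ ≤ c m^{1/ν}` — "The chiral Ward identity (3.43) and `X ≠ 0` imply that the
clustering rate `κ(m)` satisfies `κ(m) ≤ const m^{1/ν}` (4.19) as `m → 0`."
(`c = (4N(4ν)^ν/ℓ)^{1/ν}`, `ℓ = liminf_{m→0+} s(m)`.)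
[cite: SalmhoferSeiler1991, Cor. 4.4 (4) (4.19) and Remark 3.12][cite: SalmhoferSeiler1992Erratum, (5)] -/
theorem njl_clusteringRate_le_rpow_of_orderParameter (hν : 1 ≤ ν) {N : ℕ} (hN : 1 ≤ N)
    (hX : 0 < liminf (fun m : ℝ => njlCondensate ν N m) (𝓝[>] (0 : ℝ))) :
    ∃ c : ℝ, 0 < c ∧ ∃ m₀ : ℝ, 0 < m₀ ∧ ∀ m : ℝ, 0 < m → m < m₀ → ∀ κ : ℝ, 0 < κ →
      (∀ (x : Site ν) (i : Fin ν),
        |njlTwoPoint N m x - njlCondensate ν N m ^ 2| ≤ Real.exp (-κ * |(x i : ℝ)|)) →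
      κ ≤ c * m ^ (1 / (ν : ℝ)) := by
  have hνpos : (0 : ℝ) < ν := by exact_mod_cast (show 0 < ν by omega)
  set s : ℝ → ℝ := fun m => njlCondensate ν N m with hs
  set ℓ := liminf s (𝓝[>] (0 : ℝ)) with hℓ
  have hpos : 0 < ℓ := hX
  have hs0 : ∀ᶠ m in 𝓝[>] (0 : ℝ), 0 ≤ s m := by
    filter_upwards [self_mem_nhdsWithin] with m hm
    exact njlCondensate_nonneg hν hN hm
  have hev : ∀ᶠ m in 𝓝[>] (0 : ℝ), ℓ / 2 < s m :=
    eventually_lt_of_lt_liminf (by rw [hℓ]; linarith) (isBoundedUnder_of_eventually_ge hs0)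
  -- a mass interval `(0, ε)` on which `s > ℓ/2`
  rw [eventually_nhdsWithin_iff, Metric.eventually_nhds_iff] at hev
  obtain ⟨ε, hε, hεs⟩ := hev
  -- constants
  set A : ℝ := 2 * N * (4 * ν) ^ ν with hA
  have hA0 : 0 < A := by positivity
  set B : ℝ := 2 * A / ℓ with hB
  have hB0 : 0 < B := by positivity
  set m₁ : ℝ := (ν : ℝ) ^ ν / B with hm₁
  have hm₁0 : 0 < m₁ := by positivity
  refine ⟨B ^ (1 / (ν : ℝ)), by positivity, min ε m₁, lt_min hε hm₁0, fun m hm hmm₀ κ hκ hcl => ?_⟩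
  have hmε : m < ε := hmm₀.trans_le (min_le_left _ _)
  have hmm₁ : m < m₁ := hmm₀.trans_le (min_le_right _ _)
  have hsm : ℓ / 2 < s m := hεs (by rwa [dist_zero_right, Real.norm_eq_abs, abs_of_pos hm]) hm
  -- the quantitative bound for `κ' = min κ ν`
  set κ' := min κ ν with hκ'
  have hκ'0 : 0 < κ' := lt_min hκ hνpos
  have hq := njlCondensate_mul_rate_pow_le hν hN hm hκ'0 (min_le_right _ _)
    (prefactorFree_mono (min_le_left _ _) hcl)
  -- `κ'^ν ≤ B m`
  have hκ'B : κ' ^ ν ≤ B * m := by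
    have h1 : ℓ / 2 * κ' ^ ν ≤ A * m := by
      calc ℓ / 2 * κ' ^ ν ≤ s m * κ' ^ ν :=
            mul_le_mul_of_nonneg_right hsm.le (pow_nonneg hκ'0.le ν)
        _ ≤ A * m := by rw [hA]; exact hq
    rw [hB]
    have hℓ2 : 0 < ℓ / 2 := by linarith
    calc κ' ^ ν = (ℓ / 2 * κ' ^ ν) / (ℓ / 2) := by field_simp
      _ ≤ A * m / (ℓ / 2) := div_le_div_of_nonneg_right h1 hℓ2.le
      _ = 2 * A / ℓ * m := by field_simp
  -- `κ < ν` (else `ν^ν ≤ B m < B m₁ = ν^ν`), so `κ' = κ`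
  have hκν : κ' = κ := by
    rw [hκ']
    refine min_eq_left (le_of_lt ?_)
    by_contra hge
    rw [not_lt] at hge
    have h1 : κ' = ν := by rw [hκ']; exact min_eq_right hge
    rw [h1] at hκ'B
    have h2 : B * m < B * m₁ := mul_lt_mul_of_pos_left hmm₁ hB0
    have h3 : B * m₁ = (ν : ℝ) ^ ν := by rw [hm₁]; field_simp
    linarith
  rw [hκν] at hκ'B
  -- take `ν`-th roots
  calc κ = (κ ^ ν) ^ (1 / (ν : ℝ)) := by
        rw [one_div, Real.pow_rpow_inv_natCast hκ.le (by omega)]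
    _ ≤ (B * m) ^ (1 / (ν : ℝ)) :=
        Real.rpow_le_rpow (pow_nonneg hκ.le ν) hκ'B (by positivity)
    _ = B ^ (1 / (ν : ℝ)) * m ^ (1 / (ν : ℝ)) := Real.mul_rpow hB0.le hm.le

/-- The infinite-volume condensate has the convergence property used by the tree's Cor. 4.4 (1)
(`njl_chiralOrderParameter_bounds`): along the even tori `⟨σ_0⟩_Λ(m) → s(m)`.
[cite: SalmhoferSeiler1991, Cor. 3.9 and Thm. 4.3] -/
theorem njlCondensate_tendsto_even {N : ℕ} (hN : 1 ≤ N) (hν : 1 ≤ ν) (m : ℝ) (hm : 0 < m) :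
    ∃ (Ls : ℕ → ℕ) (_ : ∀ j, NeZero (Ls j)), (∀ j, Even (Ls j)) ∧ Tendsto Ls atTop atTop ∧
      Tendsto (fun j => expect (ν := ν) (L := Ls j) N m (njlBondCoeff N) (X 0)) atTop
        (𝓝 (njlCondensate ν N m)) := by
  refine ⟨fun j => 2 * j + 2, neZero_two_mul_add_two, fun j => ⟨j + 1, by ring⟩,
    tendsto_two_mul_add_two, ?_⟩
  haveI := neZero_two_mul_add_two
  have h := tendsto_njlState hN hν hm.ne' (X (0 : Site ν)) (fun j => 2 * j + 2)
    tendsto_two_mul_add_two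
  simp_rw [rename_X, torusProj_zero] at h
  exact h

/-- **Corollary 4.4 (4) (Salmhofer–Seiler), (4.19): the clustering rate vanishes at least like
`m^{1/ν}`.**  Let `ν ≥ 3`, `N ≥ 1` and `2S(ν)/N < 1` (so that chiral symmetry is broken,
`X = liminf_{m→0} 2N s(m) > 0`, Cor. 4.4 (1) — the tree's `njl_chiralOrderParameter_bounds`).
There are `c > 0` and `m₀ > 0` such that for every mass `0 < m < m₀`, EVERY rate `κ > 0` for
which the prefactor-free clustering (5) holds at `m` satisfies `κ ≤ c m^{1/ν}`.
[cite: SalmhoferSeiler1991, Cor. 4.4 (1), (4) (4.19)][cite: SalmhoferSeiler1992Erratum, (5)] -/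
theorem njl_clusteringRate_le_rpow (hν : 3 ≤ ν) {N : ℕ} (hN : 1 ≤ N) (hS : 2 * fluctS ν / N < 1) :
    ∃ c : ℝ, 0 < c ∧ ∃ m₀ : ℝ, 0 < m₀ ∧ ∀ m : ℝ, 0 < m → m < m₀ → ∀ κ : ℝ, 0 < κ →
      (∀ (x : Site ν) (i : Fin ν),
        |njlTwoPoint N m x - njlCondensate ν N m ^ 2| ≤ Real.exp (-κ * |(x i : ℝ)|)) →
      κ ≤ c * m ^ (1 / (ν : ℝ)) := by
  have hν1 : 1 ≤ ν := by omega
  obtain ⟨-, -, hpos⟩ := njl_chiralOrderParameter_bounds hν hN hS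
    (s := fun m => njlCondensate ν N m) (fun m hm => njlCondensate_tendsto_even hN hν1 m hm)
  exact njl_clusteringRate_le_rpow_of_orderParameter hν1 hN hpos

/-- **Remark 3.12 (weak Goldstone theorem), sharp form: `κ(m) → 0` as `m → 0`.**  Under
`2S(ν)/N < 1` (`ν ≥ 3`, `N ≥ 1`): every choice `m ↦ κ(m) > 0` of rates for which the prefactor-free
clustering (5) holds at each `m > 0` tends to `0` as `m → 0+` — "if chiral symmetry is broken in
the sense of `X ≠ 0`, the mass gap `κ(m)` must go to zero as the mass vanishes".
[cite: SalmhoferSeiler1991, Remark 3.12 and Cor. 4.4 (4)][cite: SalmhoferSeiler1992Erratum, (5) and last paragraph] -/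
theorem njl_clusteringRate_tendsto_zero (hν : 3 ≤ ν) {N : ℕ} (hN : 1 ≤ N) (hS : 2 * fluctS ν / N < 1)
    {κ : ℝ → ℝ} (hκ0 : ∀ m : ℝ, 0 < m → 0 < κ m)
    (hκ : ∀ m : ℝ, 0 < m → ∀ (x : Site ν) (i : Fin ν),
      |njlTwoPoint N m x - njlCondensate ν N m ^ 2| ≤ Real.exp (-κ m * |(x i : ℝ)|)) :
    Tendsto κ (𝓝[>] (0 : ℝ)) (𝓝 0) := by
  obtain ⟨c, hc, m₀, hm₀, h⟩ := njl_clusteringRate_le_rpow hν hN hS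
  have hνpos : (0 : ℝ) < ν := by exact_mod_cast (show 0 < ν by omega)
  -- `c m^{1/ν} → 0`
  have hup : Tendsto (fun m : ℝ => c * m ^ (1 / (ν : ℝ))) (𝓝[>] (0 : ℝ)) (𝓝 0) := by
    have h1 : Tendsto (fun m : ℝ => m ^ (1 / (ν : ℝ))) (𝓝 (0 : ℝ)) (𝓝 ((0 : ℝ) ^ (1 / (ν : ℝ)))) :=
      (Real.continuous_rpow_const (by positivity)).tendsto 0
    rw [Real.zero_rpow (by positivity)] at h1
    have h2 := (h1.const_mul c).mono_left (nhdsWithin_le_nhds (s := Set.Ioi (0 : ℝ)))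
    rwa [mul_zero] at h2
  refine tendsto_of_tendsto_of_tendsto_of_le_of_le' tendsto_const_nhds hup ?_ ?_
  · filter_upwards [self_mem_nhdsWithin] with m hm
    exact (hκ0 m hm).le
  · have hmem : Set.Ioo (0 : ℝ) m₀ ∈ 𝓝[>] (0 : ℝ) := Ioo_mem_nhdsGT hm₀
    filter_upwards [hmem] with m hm
    exact h m hm.1 hm.2 (κ m) (hκ0 m hm.1) (hκ m hm.1)

/-- **Cor. 4.4 (4) for strongly coupled lattice QED (`N = 1`, `ν ≥ 4`) and the NJL models with
`N ≥ 2`, `ν ≥ 3`**, hypothesis-free (`2S(ν)/N < 1` certified in the tree,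
`two_mul_fluctS_div_lt_one`): the rates of the prefactor-free clustering obey
`κ(m) ≤ c m^{1/ν}` for small `m`. [cite: SalmhoferSeiler1991, Cor. 4.4 (1), (4) (4.19)] -/
theorem njl_clusteringRate_le_rpow' (hν : 3 ≤ ν) {N : ℕ} (hN : 1 ≤ N) (h : 4 ≤ ν ∨ 2 ≤ N) :
    ∃ c : ℝ, 0 < c ∧ ∃ m₀ : ℝ, 0 < m₀ ∧ ∀ m : ℝ, 0 < m → m < m₀ → ∀ κ : ℝ, 0 < κ →
      (∀ (x : Site ν) (i : Fin ν),
        |njlTwoPoint N m x - njlCondensate ν N m ^ 2| ≤ Real.exp (-κ * |(x i : ℝ)|)) →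
      κ ≤ c * m ^ (1 / (ν : ℝ)) :=
  njl_clusteringRate_le_rpow hν hN (two_mul_fluctS_div_lt_one hν hN h)

/-- **At every fixed mass an admissible rate exists** (Erratum (5), the tree's
`njl_twoPoint_clustering_prefactorFree`), so Cor. 4.4 (4) is not vacuous: for `0 < m < m₀` the
rate `κ(m)` of (5) satisfies `0 < κ(m) ≤ c m^{1/ν}`. [cite: SalmhoferSeiler1992Erratum, (5)][cite: SalmhoferSeiler1991, Cor. 4.4 (4) (4.19)] -/
theorem njl_exists_clusteringRate_le_rpow (hν : 3 ≤ ν) {N : ℕ} (hN : 1 ≤ N)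
    (hS : 2 * fluctS ν / N < 1) :
    ∃ c : ℝ, 0 < c ∧ ∃ m₀ : ℝ, 0 < m₀ ∧ ∀ m : ℝ, 0 < m → m < m₀ → ∃ κ : ℝ, 0 < κ ∧
      (∀ (x : Site ν) (i : Fin ν),
        |njlTwoPoint N m x - njlCondensate ν N m ^ 2| ≤ Real.exp (-κ * |(x i : ℝ)|)) ∧
      κ ≤ c * m ^ (1 / (ν : ℝ)) := by
  obtain ⟨c, hc, m₀, hm₀, h⟩ := njl_clusteringRate_le_rpow hν hN hS
  refine ⟨c, hc, m₀, hm₀, fun m hm hmm₀ => ?_⟩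
  obtain ⟨κ, hκ, hcl⟩ := njl_twoPoint_clustering_prefactorFree (ν := ν) hN (by omega) hm
  exact ⟨κ, hκ, hcl, h m hm hmm₀ κ hκ hcl⟩
end ComplexSpin

end Literature.MathematicalPhysics.StatisticalMechanics

end
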